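import Mathlib.Data.Complex.Basic
import Mathlib.Algebra.CharZero.Infinite
import Mathlib.Algebra.Polynomial.Roots
import Mathlib.Combinatorics.Colex
import Mathlib.Combinatorics.Enumerative.Composition
import Mathlib.LinearAlgebra.Dimension.StrongRankCondition
import Mathlib.RingTheory.MvPolynomial.Basic
import Literature.Computability.AlgebraicComplexity.Elusive
import HarnessLib

/-!
# Narayanan's explicit `(⌊m^{9/10}⌋, 2)`-elusive curve of exponential degree (2026)

Topic: `Literature/Computability/AlgebraicComplexity`. One NAMED FACT (a `Prop`, nothing
asserted), vendored while grounding route `ValiantsHypothesis/GirthSidon`, item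
`stmt-ValiantsHypothesis-6534`
(`Summit.ValiantsHypothesis.ValiantsHypothesis.Theses.GirthSidon.MomentCurveElusive`): it is the
nearest printed result to that item — elusiveness in exactly Raz's `(m^{0.9}, 2)` regime against
ALL quadratic maps — but for the doubling curve, of degree `2^{m-1}` (exponential), whereas the
route's target asks for a curve of polynomial height. It does NOT ground (imply) that item; it
records the state of the art for refuters and planners of the elusive-curve routes
(`Elusive`, `GirthSidon`, `BinomialElusive`).

* `Narayanan2026_thm_1` — A. K. Narayanan, *Arithmetic circuit lower bounds from sumset
  expansion*, arXiv:2607.15848 (2026), Theorem 1 (p. 2): "For large enough `m`,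
  `z ↦ (z, z², z⁴, …, z^{2^{m-1}})` is `(⌊m^{9/10}⌋, 2)`-elusive." (Definition 1 there =
  Raz 2010, Def. 1.1 = the tree's `IsElusive`, over `ℂ`.)

## Rendering

* The curve is the monomial curve `i ↦ X 0 ^ 2^i : Fin m → ℂ[X_0]` (`MvPolynomial (Fin 1) ℂ`),
  0-based index `i < m` for the printed exponents `2^0, …, 2^{m-1}`; its image under
  `polyMapEval` is `{(z^{2^i})_i : z ∈ ℂ} = f(ℂ)`.
* "`(⌊m^{9/10}⌋, 2)`-elusive" is rendered without real powers, as in the tree's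
  `Raz2010_result_1` (`s ≥ m^{0.9}` ↦ `m^9 ≤ s^{10}`): `(s, 2)`-elusive for every `s : ℕ` with
  `s^{10} ≤ m^9`. This is equivalent to the printed form: for naturals
  `s^{10} ≤ m^9 ↔ s ≤ ⌊m^{9/10}⌋`, and elusiveness is antitone in `s` (`IsElusive.anti_left`,
  proved in `Elusive.lean`), so the family of statements over all such `s` is the single
  statement at `s = ⌊m^{9/10}⌋`.
* "For large enough `m`" ↦ `∃ m₀, ∀ m ≥ m₀`.
* Status: arXiv preprint (July 2026), not refereed at the time of vendoring; proof = §2 of the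
  paper (iterated sumsets of `{1, 2, 4, …, 2^{m-1}}` expand by uniqueness of binary expansion;
  hitting set of `p`-th roots of unity; Chebotarev's theorem on minors of the Fourier matrix).
  Users take `(h : Narayanan2026_thm_1)`.
* Context from the same paper, not vendored: Remark 1 (p. 11) — the curve is NOT
  `(m-1, 2)`-elusive (it lies in the image of `(z₁,…,z_{m-1}) ↦ (z₁,…,z_i,z_i²,z_{i+1},…)`);
  Remark 2 (p. 11) — its multilinearisation is only poly(`m`)-definable, "insufficient for
  lower bounds", whereas an explicit `(m^{9/10}, 2)`-elusive curve of degree `2^{m^{o(1)}}`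
  would give `VP ≠ VNP` (Raz 2010, §1 result 1 = the tree's `Raz2010_result_1`).
-/

namespace Literature.Computability.AlgebraicComplexity

/-- **Narayanan 2026, Theorem 1** (arXiv:2607.15848, p. 2), verbatim: "For large enough `m`,
`z ↦ (z, z², z⁴, …, z^{2^{m−1}})` is `(⌊m^{9/10}⌋, 2)`-elusive." Over `ℂ`, elusive in the
sense of Raz 2010, Def. 1.1 (`IsElusive`: the image of the curve is contained in the image of
no polynomial map `ℂ^s → ℂ^m` whose coordinates have total degree `≤ 2`), `s = ⌊m^{9/10}⌋`;
rendered for all `s` with `s^{10} ≤ m^9`, which is equivalent by `IsElusive.anti_left`.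
Nearest printed result to — but, having degree `2^{m-1}` instead of polynomial height,
different from and not implying — the target
`Summit.ValiantsHypothesis.ValiantsHypothesis.Theses.GirthSidon.MomentCurveElusive`
(item stmt-ValiantsHypothesis-6534). Preprint, unrefereed. [cite: Narayanan2026, Thm 1] -/
def Narayanan2026_thm_1 : Prop :=
  ∃ m₀ : ℕ, ∀ m ≥ m₀, ∀ s : ℕ, s ^ 10 ≤ m ^ 9 →
    IsElusive (fun i : Fin m => (MvPolynomial.X 0 : MvPolynomial (Fin 1) ℂ) ^ (2 ^ (i : ℕ))) s 2

/-! ### Proof of `Narayanan2026_thm_1`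

We follow the architecture of the printed proof (arXiv:2607.15848, §2, pp. 8–9): a dimension
count produces, for every degree-`≤ 2` map `Γ : ℂˢ → ℂᵐ`, a nonzero polynomial `h_Γ` in the
span of certain multilinear monomials with `h_Γ ∘ Γ = 0`; on the curve, distinct multilinear
monomials `x^a` become distinct powers `z^{Σ aᵢ 2^i}` (uniqueness of binary expansion), so
`h_Γ ∘ f` is a nonzero univariate polynomial and the curve is not contained in `Γ(ℂˢ)`.

Deviations from the printed proof (shorter roads in Lean, same theorem):
* the paper exhibits an explicit non-root of `h_Γ ∘ f` among `p`-th roots of unity via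
  Chebotarev's theorem on minors of the Fourier matrix; for the statement of Theorem 1 it
  suffices that a nonzero univariate polynomial over the infinite field `ℂ` has some non-root
  (`Polynomial.funext`), so Chebotarev is not needed;
* instead of all weight-`ℓ` multilinear monomials (`ℓ = ⌊s/2⌋`, counted by binomials) we use
  the `16^k` "block" monomials `∏_{j<k} x_{16j + c_j}`, `c : Fin k → Fin 16`, `k = s + 1`
  (needs `16 (s+1) ≤ m`, which holds for `m ≥ 32^{10}` when `s^{10} ≤ m^9`), and bound the
  dimension of polynomials of degree `≤ d` in `s` variables crudely by `2^{s+d}` (stars and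
  bars, as an injection into compositions of `s + d + 1`); `16^{s+1} > 2^{s+2(s+1)}`.
-/

section Narayanan2026Proof

open MvPolynomial

/-- Stars and bars (crude form): the exponent vectors `n : Fin s →₀ ℕ` of degree `≤ d` inject
into the compositions of `s + d + 1` (of which there are `2^(s+d)`, `composition_card`) via
`n ↦ (n₀+1, …, n_{s-1}+1, d - |n| + 1)`. [folklore] -/
private theorem exists_injective_degreeLE_composition (s d : ℕ) :
    ∃ φ : ({n : Fin s →₀ ℕ | (n.sum fun _ e => e) ≤ d} : Set (Fin s →₀ ℕ)) →
      Composition (s + d + 1), Function.Injective φ := by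
  classical
  have hdeg : ∀ n : Fin s →₀ ℕ, (n.sum fun _ e => e) = ∑ i, n i := fun n =>
    n.sum_fintype _ fun _ => rfl
  let φ : ({n : Fin s →₀ ℕ | (n.sum fun _ e => e) ≤ d} : Set (Fin s →₀ ℕ)) →
      Composition (s + d + 1) := fun n =>
    { blocks := List.ofFn (fun i : Fin s => n.1 i + 1) ++ [d - (∑ i, n.1 i) + 1]
      blocks_pos := by
        intro i hi
        simp only [List.mem_append, List.mem_ofFn, List.mem_singleton] at hi
        rcases hi with ⟨j, rfl⟩ | rfl <;> exact Nat.succ_pos _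
      blocks_sum := by
        have hn : ∑ i, n.1 i ≤ d := by simpa [hdeg] using n.2
        simp only [List.sum_append, List.sum_ofFn, List.sum_cons, List.sum_nil, add_zero,
          Finset.sum_add_distrib, Finset.sum_const, Finset.card_univ, Fintype.card_fin,
          smul_eq_mul, mul_one]
        omega }
  refine ⟨φ, ?_⟩
  rintro ⟨n, hn⟩ ⟨n', hn'⟩ h
  have hb := congrArg Composition.blocks h
  have hl : List.ofFn (fun i : Fin s => n i + 1) = List.ofFn (fun i : Fin s => n' i + 1) :=
    List.append_inj_left hb (by simp)
  rw [List.ofFn_inj] at hl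
  ext i
  simpa using congrFun hl i

/-- Dimension count: more than `2^(s+d)` polynomials in `s` variables of total degree `≤ d` are
linearly dependent (they lie in `restrictTotalDegree (Fin s) ℂ d`, whose monomial basis has at
most `2^(s+d)` elements by `exists_injective_degreeLE_composition`). [folklore] -/
private theorem exists_relation_of_card_lt {ι : Type*} [Fintype ι] {s d : ℕ}
    (v : ι → MvPolynomial (Fin s) ℂ) (hv : ∀ i, (v i).totalDegree ≤ d)
    (hcard : 2 ^ (s + d) < Fintype.card ι) :
    ∃ g : ι → ℂ, ∑ i, g i • v i = 0 ∧ ∃ i, g i ≠ 0 := by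
  classical
  let S : Set (Fin s →₀ ℕ) := {n | (n.sum fun _ e => e) ≤ d}
  obtain ⟨φ, hφ⟩ := exists_injective_degreeLE_composition s d
  haveI : Finite S := Finite.of_injective φ hφ
  letI : Fintype S := Fintype.ofFinite S
  have hS : Fintype.card S ≤ 2 ^ (s + d) := by
    simpa [composition_card] using Fintype.card_le_of_injective φ hφ
  let w : ι → restrictSupport ℂ S := fun i =>
    ⟨v i, (mem_restrictTotalDegree (Fin s) d (v i)).2 (hv i)⟩
  have hw : ¬ LinearIndependent ℂ w := fun hli => by
    have h1 := (basisRestrictSupport ℂ S).card_le_card_of_linearIndependent hli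
    omega
  obtain ⟨g, hg, i, hi⟩ := Fintype.not_linearIndependent_iff.1 hw
  refine ⟨g, ?_, i, hi⟩
  simpa [w] using congrArg Subtype.val hg

/-- Uniqueness of binary expansion, in the form needed: the exponent map of the block monomials,
`c ↦ ∑_{j<k} 2^(16 j + c j)` for `c : Fin k → Fin 16`, is injective. [folklore] -/
private theorem blockExp_injective (k : ℕ) :
    Function.Injective fun c : Fin k → Fin 16 => ∑ j : Fin k, 2 ^ (16 * (j : ℕ) + (c j : ℕ)) := by
  classical
  -- the set of binary digits of the exponent
  let T : (Fin k → Fin 16) → Finset ℕ := fun c =>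
    Finset.univ.image fun j : Fin k => 16 * (j : ℕ) + (c j : ℕ)
  have hinj : ∀ c : Fin k → Fin 16,
      Set.InjOn (fun j : Fin k => 16 * (j : ℕ) + (c j : ℕ)) ↑(Finset.univ : Finset (Fin k)) := by
    intro c j _ j' _ h
    have hj := (c j).2
    have hj' := (c j').2
    apply Fin.ext
    simp only at h
    omega
  have hT : ∀ c : Fin k → Fin 16,
      (∑ j : Fin k, 2 ^ (16 * (j : ℕ) + (c j : ℕ))) = ∑ i ∈ T c, 2 ^ i := by
    intro c
    rw [Finset.sum_image (hinj c)]
  intro c c' h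
  simp only at h
  rw [hT, hT] at h
  have hTT : T c = T c' := Finset.geomSum_injective (n := 2) le_rfl h
  funext j
  have hmem : 16 * (j : ℕ) + (c j : ℕ) ∈ T c' := by
    rw [← hTT]
    exact Finset.mem_image.2 ⟨j, Finset.mem_univ _, rfl⟩
  obtain ⟨j', -, hj'⟩ := Finset.mem_image.1 hmem
  have h1 := (c j).2
  have h2 := (c' j').2
  have hjj : (j' : ℕ) = j := by omega
  have hjj' : j' = j := Fin.ext hjj
  subst hjj'
  exact Fin.ext (by omega)

/-- **Narayanan 2026, Theorem 1** holds: for `m ≥ 32^{10}` and every `s` with `s^{10} ≤ m^9`,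
the doubling curve `z ↦ (z^{2^i})_{i<m}` is `(s, 2)`-elusive. Proof as in arXiv:2607.15848, §2
(dimension count + uniqueness of binary expansion), with the explicit Chebotarev hitting set
replaced by "a nonzero polynomial over `ℂ` has a non-root". [cite: Narayanan2026, Thm 1] -/
theorem Narayanan2026_thm_1_holds : Narayanan2026_thm_1 := by
  classical
  refine ⟨32 ^ 10, fun m hm s hs Γ hΓ hsub => ?_⟩
  -- Step 0: arithmetic, `16 (s + 1) ≤ m`.
  have h32 : 32 * s ≤ m := by
    have h : (32 * s) ^ 10 ≤ m ^ 10 := by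
      calc (32 * s) ^ 10 = 32 ^ 10 * s ^ 10 := mul_pow _ _ _
        _ ≤ m * m ^ 9 := Nat.mul_le_mul hm hs
        _ = m ^ 10 := by ring
    exact (Nat.pow_le_pow_iff_left (by norm_num)).1 h
  have hm32 : 32 ≤ m := le_trans (by norm_num) hm
  set k : ℕ := s + 1 with hk
  have hkm : 16 * k ≤ m := by omega
  -- the variable `16 j + t` of block `j`
  let idx : Fin k → Fin 16 → Fin m := fun j t =>
    ⟨16 * (j : ℕ) + (t : ℕ), by have := j.2; have := t.2; omega⟩
  -- Step 1: the block products `v c = ∏_j Γ_{16 j + c j}` have degree `≤ 2k` and are too many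
  -- to be linearly independent.
  let v : (Fin k → Fin 16) → MvPolynomial (Fin s) ℂ := fun c => ∏ j, Γ (idx j (c j))
  have hvdeg : ∀ c, (v c).totalDegree ≤ 2 * k := by
    intro c
    calc (v c).totalDegree ≤ ∑ j, (Γ (idx j (c j))).totalDegree := totalDegree_finsetProd _ _
      _ ≤ ∑ _j : Fin k, 2 := Finset.sum_le_sum fun j _ => hΓ _
      _ = 2 * k := by simp [mul_comm]
  have hcard : 2 ^ (s + 2 * k) < Fintype.card (Fin k → Fin 16) := by
    rw [Fintype.card_fun, Fintype.card_fin, Fintype.card_fin,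
      show (16 : ℕ) = 2 ^ 4 by norm_num, ← pow_mul]
    exact Nat.pow_lt_pow_right (by norm_num) (by omega)
  obtain ⟨g, hg, c₀, hc₀⟩ := exists_relation_of_card_lt v hvdeg hcard
  -- Step 2: on the curve the relation becomes the univariate polynomial
  -- `P = ∑_c g_c X^{e c}`, `e c = ∑_j 2^(16 j + c j)`, which is nonzero since `e` is injective.
  let e : (Fin k → Fin 16) → ℕ := fun c => ∑ j : Fin k, 2 ^ (16 * (j : ℕ) + (c j : ℕ))
  have he : Function.Injective e := blockExp_injective k
  let P : Polynomial ℂ := ∑ c, Polynomial.C (g c) * Polynomial.X ^ (e c)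
  have hP : P ≠ 0 := by
    intro h0
    apply hc₀
    have h1 : P.coeff (e c₀) = g c₀ := by
      simp only [P, Polynomial.finsetSum_coeff, Polynomial.coeff_C_mul, Polynomial.coeff_X_pow,
        he.eq_iff, mul_ite, mul_one, mul_zero, Finset.sum_ite_eq, Finset.mem_univ, if_true]
    rw [← h1, h0, Polynomial.coeff_zero]
  obtain ⟨z, hz⟩ : ∃ z : ℂ, P.eval z ≠ 0 := by
    by_contra h
    exact hP (Polynomial.funext fun r => by
      rw [Polynomial.eval_zero]
      exact not_not.1 (not_exists.1 h r))
  -- Step 3: the point `f(z)` of the curve lies in `Γ(ℂˢ)`, say `f(z) = Γ(y)`; evaluating the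
  -- relation at `y` gives `P(z) = 0`, a contradiction.
  obtain ⟨y, hy⟩ := hsub ⟨fun _ => z, rfl⟩
  have hy' : ∀ i : Fin m, eval y (Γ i) = z ^ (2 ^ (i : ℕ)) := by
    intro i
    have := congrFun hy i
    simpa [polyMapEval] using this
  apply hz
  have hrel := congrArg (eval y) hg
  rw [map_sum, map_zero] at hrel
  simp only [smul_eval, v, map_prod, hy'] at hrel
  -- `hrel : ∑ c, g c * ∏ j, z ^ 2 ^ (16 j + c j) = 0`
  rw [← hrel]
  simp only [P, Polynomial.eval_finsetSum, Polynomial.eval_mul, Polynomial.eval_C,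
    Polynomial.eval_pow, Polynomial.eval_X, e]
  refine Finset.sum_congr rfl fun c _ => ?_
  rw [← Finset.prod_pow_eq_pow_sum]

end Narayanan2026Proof

end Literature.Computability.AlgebraicComplexity
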